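import Literature.Analysis.FluidPDE.KNSSRegularityWindow
import Literature.Analysis.FluidPDE.OseenHeat
import HarnessLib

/-!
# KNSS 2009, §4 on a finite window: decomposition of the regularity fact into Lemma 3.1
# (drift-mild form) and the smoothing of drift-mild solutions

Analysis/FluidPDE facts file on the discharge path of the named fact
`Literature.Analysis.FluidPDE.KNSS2009_regularity_boundedWeak_window` (`KNSSRegularityWindow`;
Koch–Nadirashvili–Seregin–Šverák, Acta Math. 203 (2009) = arXiv:0709.3599v1, §4, closing
paragraph, (4.8)–(4.11) with Lemma 3.1). The printed argument has two halves, which this file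
separates into two named facts sharing one interface, and glues:

1. **Lemma 3.1 (with (3.3) and §4 (ii))**: "Let `v` be the mild solution of the linear Cauchy
   problem (3.1) and (3.2) with `f_k = −u_k u` and `u₀ = 0`. By Lemma 3.1 we can write
   `u = v + w + b` with the `L^∞`-norms of `v`, `w` and `b` bounded by `N = C₁(T)M² + C₂(T)M`,
   `w_t − Δw = 0` and `b` is a function of `t` only" (arXiv p. 8); `v(t) = ∫₀ᵗ S(t−s)P∂_k f_k ds`
   ((3.3)), and `w`, `b` "are determined up to a constant" (Remark 3.1). Writing `U = v + w`
   (so `u = U + b(t)`), the semigroup law turns this into the **drift-mild identity**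
   `U(t) = e^{(t−s)Δ}U(s) − ∫ₛᵗ e^{(t−σ)Δ}P∇·(u ⊗ u)(σ) dσ`, `0 < s < t < T`, `u = U + b`, which is
   the form in which §4 consumes the decomposition. This is the named fact
   `KNSS2009_weak_driftMild` below, for `n = 3`, with `e^{τΔ}P∇·` realised by the tree's
   Oseen–heat operator `oseenHeat` (`OseenHeat.lean`) — see `driftDuhamel`.
2. **The smoothing half** ((4.10) `‖∇ᵏₓu‖_{L^∞(ℝⁿ×(δ,T))} ≤ C(k, δ, T, M)`, (4.11)
   `‖∇ᵏₓ∂ₜ(u − b)‖_{L^∞(ℝⁿ×(δ,T))} ≤ C`, the vorticity equation (4.8) "satisfied in the sense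
   of distributions", and `div u = 0`), which the source derives for `u = v + w + b` from
   Proposition 4.1, the linear estimates (3.10)–(3.14) and Serrin's bootstrap: the named fact
   `KNSS2009_driftMild_regularity` below asserts exactly these conclusions, in the elementary
   rendering of `KNSSRegularityWindow` (classical derivatives of the representative `U`,
   Lipschitz-in-time derivatives, time-integrated vorticity equation), for every pair `(U, b)`
   satisfying the drift-mild identity with bounds `N` on `(0, T)`.

`KNSS2009_regularity_boundedWeak_window_of_driftMild` proves the window fact from the two
(the glue is bookkeeping of constants: `N = N(M, T)` from part 1 feeds `C(k, δ), L(k, δ)` of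
part 2). Both parts are theories of their own (part 1: uniqueness for the weak Stokes system in
`L^∞` modulo `x`-independent functions, by duality and the Liouville theorem for
`curl z = 0, div z = 0`; part 2: `L^∞` smoothing estimates of all orders for the Oseen kernel) and
are discharged in sibling files; nothing is proved here beyond the glue.

## The interface `IsKNSSDriftMild T N U b`

`U : ℝ → E → E` jointly measurable with `‖U‖ ≤ N` on `(0, T) × E`, `b : ℝ → E` measurable with
`‖b‖ ≤ N`, `U(t, ·)` weakly divergence free for a.e. `t ∈ (0, T)` (from `div u = 0` in
distributions), and for all `0 < s < t < T` and all `x`,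
`U(t, x) = (e^{(t−s)Δ}U(s))(x) − ∫ₛᵗ (𝒩_{t−σ}[(U(σ) + b(σ)) ⊗ (U(σ) + b(σ))])(x) dσ`
(`driftDuhamel`), where `𝒩_τ F = e^{τΔ}P∇·F` is `oseenHeat τ F` assembled into a vector over the
frame `stdOrthonormalBasis ℝ E` and `(v ⊗ v)_{jk} = ⟪v, eⱼ⟫⟪v, e_k⟫` (`driftTensor`). The sign is
that of KNSS (3.3)/(4.3) with `f_k = −u_k u`: `(∇·F)ᵢ = Σⱼ ∂ⱼFⱼᵢ`, `(u·∇)u = ∇·(u ⊗ u)` for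
`div u = 0`, so `uₜ = Δu − P∇·(u ⊗ u)` and the Duhamel term enters with a minus sign. Viscosity
`ν = 1` as in the source. The drift `b` is merely bounded measurable (a pure "parasitic solution"
`u(x, t) = b(t)`, KNSS §1 p. 3, has `U = 0`), which is why `b` is kept explicit rather than
absorbed (the drift-mild identity with `b ≠ const` is not the Navier–Stokes mild equation).

## References

* G. Koch, N. Nadirashvili, G. Seregin, V. Šverák, *Liouville theorems for the Navier–Stokes
  equations and applications*, Acta Math. 203 (2009) 83–105 = arXiv:0709.3599v1: §3 (3.3),
  Lemma 3.1 with (3.17)–(3.18), Remark 3.1; §4 (ii), (4.3)–(4.4), Proposition 4.1, and the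
  closing paragraph with (4.7)–(4.11). [KochNadirashviliSereginSverak2009]
-/

noncomputable section

open MeasureTheory Set Function Filter TopologicalSpace InnerProductSpace
open scoped RealInnerProductSpace Laplacian ContDiff

namespace Literature.Analysis.FluidPDE

/-! ### The drift-mild interface -/

section Interface

variable {E : Type*} [NormedAddCommGroup E] [InnerProductSpace ℝ E] [FiniteDimensional ℝ E]

/-- The frame components of the tensor `(U(σ) + b(σ)) ⊗ (U(σ) + b(σ))` of the full velocity
`u = U + b` at time `σ`: `(j, k) ↦ (y ↦ ⟪U σ y + b σ, eⱼ⟫ ⟪U σ y + b σ, e_k⟫)` in the frame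
`e = stdOrthonormalBasis ℝ E`, the matrix field fed to `oseenHeat` (KNSS 2009, §4: `f_k = −u_k u`,
i.e. `f_{jk} = −u_k u_j`; the sign is carried by `driftDuhamel`). [cite: KochNadirashviliSereginSverak2009, §4 (ii) (arXiv:0709.3599v1 p. 8)] -/
def driftTensor (U : ℝ → E → E) (b : ℝ → E) (σ : ℝ) (j k : Fin (Module.finrank ℝ E))
    (y : E) : ℝ :=
  ⟪U σ y + b σ, stdOrthonormalBasis ℝ E j⟫ * ⟪U σ y + b σ, stdOrthonormalBasis ℝ E k⟫

/-- Unfolding `driftTensor`. [folklore] -/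
@[simp]
theorem driftTensor_apply (U : ℝ → E → E) (b : ℝ → E) (σ : ℝ)
    (j k : Fin (Module.finrank ℝ E)) (y : E) :
    driftTensor U b σ j k y =
      ⟪U σ y + b σ, stdOrthonormalBasis ℝ E j⟫ * ⟪U σ y + b σ, stdOrthonormalBasis ℝ E k⟫ :=
  rfl

/-- `driftTensor` is symmetric in the frame indices. [folklore] -/
theorem driftTensor_comm (U : ℝ → E → E) (b : ℝ → E) (σ : ℝ)
    (j k : Fin (Module.finrank ℝ E)) (y : E) :
    driftTensor U b σ j k y = driftTensor U b σ k j y := by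
  simp only [driftTensor_apply, mul_comm]

variable [MeasurableSpace E] [BorelSpace E]

/-- **The Oseen–Duhamel integral with drift** between times `s` and `t`:
`driftDuhamel U b s t x = ∫ₛᵗ 𝒩_{t−σ}[(U(σ) + b(σ)) ⊗ (U(σ) + b(σ))](x) dσ`, where
`𝒩_τ F = e^{τΔ} P ∇·F` is the tree's `oseenHeat τ F` (components in the frame
`stdOrthonormalBasis ℝ E`, assembled into a vector inside the integral). This is KNSS's
`−(v(t) − S(t−s)v(s))`, `v` the mild solution (3.3) of the linear Stokes problem with
`f_k = −u_k u`, `u = U + b` (equivalently `−B(u,u)` of (4.3) restarted at time `s`). Interval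
integral in `σ` (Bochner; junk value `0` for a non-integrable integrand — for bounded measurable
`U`, `b` the integrand is bounded by `C (t−σ)^{-1/2}` and integrable). [cite: KochNadirashviliSereginSverak2009, §3 (3.3) and §4 (4.3)–(4.4) (arXiv:0709.3599v1 pp. 6–8)] -/
def driftDuhamel (U : ℝ → E → E) (b : ℝ → E) (s t : ℝ) (x : E) : E :=
  ∫ σ in s..t, ∑ i, oseenHeat (t - σ) (driftTensor U b σ) i x • stdOrthonormalBasis ℝ E i

/-- Unfolding `driftDuhamel`. [folklore] -/
theorem driftDuhamel_apply (U : ℝ → E → E) (b : ℝ → E) (s t : ℝ) (x : E) :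
    driftDuhamel U b s t x =
      ∫ σ in s..t, ∑ i, oseenHeat (t - σ) (driftTensor U b σ) i x • stdOrthonormalBasis ℝ E i :=
  rfl

/-- `driftDuhamel U b t t = 0` (empty time interval). [folklore] -/
@[simp]
theorem driftDuhamel_self (U : ℝ → E → E) (b : ℝ → E) (t : ℝ) (x : E) :
    driftDuhamel U b t t x = 0 := by
  simp [driftDuhamel]

/-- **Drift-mild velocity fields on the window `(0, T)` with bound `N`** — the output of KNSS's
Lemma 3.1 applied to a bounded weak Navier–Stokes solution `u = U + b(t)` (`U = v + w`), in the
form consumed by the closing paragraph of §4: `b` is measurable with `‖b(t)‖ ≤ N` for all `t`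
((3.18)), `U` is jointly measurable with `‖U(t, x)‖ ≤ N` on `(0, T) × E` ((3.10), (3.17)),
`U(t, ·)` is weakly divergence free for a.e. `t ∈ (0, T)` (`div u = 0` in distributions, §4 (ii)),
and the drift-mild identity `U(t) = e^{(t−s)Δ}U(s) − ∫ₛᵗ 𝒩_{t−σ}[(U + b) ⊗ (U + b)](σ) dσ` holds
pointwise for all `0 < s < t < T` ((3.3) for `v` restarted at `s` by the semigroup law, plus
`w(t) = e^{(t−s)Δ}w(s)` and `e^{(t−s)Δ}b(s) = b(s)`; see the module docstring for signs). [cite: KochNadirashviliSereginSverak2009, Lemma 3.1 with (3.3), (3.17)–(3.18), Remark 3.1; §4 (ii) (arXiv:0709.3599v1 pp. 6–8)] -/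
structure IsKNSSDriftMild (T N : ℝ) (U : ℝ → E → E) (b : ℝ → E) : Prop where
  /-- The drift `b` is measurable. -/
  measurable_drift : Measurable b
  /-- The drift is bounded by `N` (everywhere; KNSS (3.18)). -/
  norm_drift_le : ∀ t, ‖b t‖ ≤ N
  /-- `U` is jointly measurable in `(t, x)`. -/
  measurable : Measurable (uncurry U)
  /-- `U` is bounded by `N` on the window (KNSS (3.10), (3.17)). -/
  norm_le : ∀ t ∈ Ioo 0 T, ∀ x, ‖U t x‖ ≤ N
  /-- `U(t, ·)` is weakly divergence free for a.e. `t` in the window. -/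
  ae_isWeaklyDivFree : ∀ᵐ t ∂((volume : Measure ℝ).restrict (Ioo 0 T)), IsWeaklyDivFree (U t)
  /-- The drift-mild identity between any two times of the window. -/
  mild : ∀ s t : ℝ, 0 < s → s < t → t < T → ∀ x,
    U t x = UnboundedOperators.heatExtension (U s) (t - s) x - driftDuhamel U b s t x

/-- Restriction of the window: a drift-mild field on `(0, T)` is one on `(0, T')` for `T' ≤ T`.
[folklore] -/
theorem IsKNSSDriftMild.mono {T N : ℝ} {U : ℝ → E → E} {b : ℝ → E}
    (h : IsKNSSDriftMild T N U b) {T' : ℝ} (hT' : T' ≤ T) : IsKNSSDriftMild T' N U b where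
  measurable_drift := h.measurable_drift
  norm_drift_le := h.norm_drift_le
  measurable := h.measurable
  norm_le := fun t ht x => h.norm_le t ⟨ht.1, ht.2.trans_le hT'⟩ x
  ae_isWeaklyDivFree :=
    ae_mono (Measure.restrict_mono (Ioo_subset_Ioo_right hT') le_rfl) h.ae_isWeaklyDivFree
  mild := fun s t hs hst ht x => h.mild s t hs hst (ht.trans_le hT') x

/-- The bound `N` of a drift-mild field on a nonempty window is nonnegative. [folklore] -/
theorem IsKNSSDriftMild.nonneg {T N : ℝ} {U : ℝ → E → E} {b : ℝ → E}
    (h : IsKNSSDriftMild T N U b) : 0 ≤ N :=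
  (norm_nonneg _).trans (h.norm_drift_le 0)

end Interface

/-! ### The two halves of KNSS §4 on a window, as named facts -/

section Facts

/-- **KNSS 2009, Lemma 3.1 for bounded weak Navier–Stokes solutions, drift-mild form** (Acta
Math. 203 (2009) = arXiv:0709.3599v1; §3 Lemma 3.1: "let `u ∈ L^∞` be any weak solution of (3.1)
in `ℝⁿ × (0,T)`, and denote by `v` the mild solution of the Cauchy problem (3.1) and (3.2) with
`u₀ = 0`. Then `u(x,t) = v(x,t) + w(x,t) + b(t)`, where `w` satisfies the heat equation
`w_t − Δw = 0` in `ℝⁿ × (0,T)` and `b` is a bounded measurable `ℝⁿ`-valued function on `(0,T)`.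
Moreover `‖w‖_{L^∞} ≤ C(T)‖u‖_{L^∞}` (3.17) and `‖b‖_{L^∞(0,T)} ≤ C(T)‖u‖_{L^∞}` (3.18)";
Remark 3.1: "`w` and `b` are determined up to a constant"; applied in §4 p. 8 with
`f_k = −u_k u`: "we can write `u = v + w + b` with the `L^∞`-norms of `v`, `w` and `b` bounded by
`N = C₁(T)M² + C₂(T)M`"). **Statement** (`n = 3`, `ν = 1`). For all `M` and `T > 0` there is `N`
such that every bounded weak solution `u` of Navier–Stokes in `ℝ³ × (0, T)`
(`IsBoundedWeakNSSolutionOn (Ioo 0 T)`) with `‖u(t, x)‖ ≤ M` on the window admits `U` (`= v + w`)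
and `b` with `IsKNSSDriftMild T N U b` (joint measurability, the bounds `N`, weak
divergence-freeness of a.e. slice, and the drift-mild identity
`U(t) = e^{(t−s)Δ}U(s) − ∫ₛᵗ e^{(t−σ)Δ}P∇·((U + b) ⊗ (U + b))(σ) dσ` for all `0 < s < t < T`, which
is (3.3) for `v` restarted by the semigroup law together with `w(t) = e^{(t−s)Δ}w(s)`) and
`u(t, ·) = U(t, ·) + b(t)` a.e. in `x` for a.e. `t ∈ (0, T)` (the rendering of an identity in
`L^∞(ℝ³ × (0, T))` for an everywhere-defined representative `U`). The parasitic part `b` is only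
bounded measurable in general (KNSS §1, p. 3). [cite: KochNadirashviliSereginSverak2009, Lemma 3.1, (3.3), (3.17)–(3.18), Remark 3.1 and §4 (ii) p. 8 (arXiv:0709.3599v1)] -/
def KNSS2009_weak_driftMild : Prop :=
  ∀ M T : ℝ, 0 < T → ∃ N : ℝ,
    ∀ ⦃u : ℝ → EuclideanSpace ℝ (Fin 3) → EuclideanSpace ℝ (Fin 3)⦄,
      IsBoundedWeakNSSolutionOn (Ioo 0 T) isOpen_Ioo 1 u →
      (∀ t ∈ Ioo 0 T, ∀ x, ‖u t x‖ ≤ M) →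
      ∃ (U : ℝ → EuclideanSpace ℝ (Fin 3) → EuclideanSpace ℝ (Fin 3))
        (b : ℝ → EuclideanSpace ℝ (Fin 3)), IsKNSSDriftMild T N U b ∧
        ∀ᵐ t ∂((volume : Measure ℝ).restrict (Ioo 0 T)), u t =ᵐ[volume] fun x => U t x + b t

/-- **KNSS 2009, §4, regularity of the decomposed solution** (Acta Math. 203 (2009) =
arXiv:0709.3599v1, §4, closing paragraph, for `u = v + w + b` as delivered by Lemma 3.1: "for
`k = 0, 1, 2, …` and `δ > 0` the derivatives `∇ᵏₓ(w + b)` are bounded by `C(k, δ)N` in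
`ℝⁿ × (δ, T)` by Proposition 4.1 … For `n = 3` the equation for `ω` is (4.8)
`ω_{i,t} − Δω_i = ∂_j(ω_j u_i − ω_i u_j)` and … this equation is satisfied in the sense of
distributions … (4.10) `‖∇ᵏₓu‖_{L^∞(ℝⁿ×(δ,T))} ≤ C(k, δ, T, M)`. Finally, using (3.14) we also
obtain for `k = 0, 1, 2, …` (4.11) `‖∇ᵏₓ∂ₜ(u − b)‖_{L^∞(ℝⁿ×(δ,T))} ≤ C(k, δ, R, M)`" (sic)).
**Statement** (`n = 3`, `ν = 1`; same elementary rendering as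
`KNSS2009_regularity_boundedWeak_window`, whose module docstring explains each clause). For all
`N` and `T > 0` there are constants `C(k, δ), L(k, δ)` such that for every drift-mild pair
`(U, b)` on `(0, T)` with bound `N` (`IsKNSSDriftMild T N U b`, i.e. `U = u − b = v + w` for a
bounded weak solution `u` decomposed as in Lemma 3.1): every slice `U(t, ·)`, `0 < t < T`, is
`C^∞` and divergence free; `‖∇ᵏₓU(t, x)‖ ≤ C(k, δ)` on `ℝ³ × (δ, T)` ((4.10); `∇ₓ` does not see
`b`); `‖∇ᵏₓU(t, x) − ∇ᵏₓU(s, x)‖ ≤ L(k, δ)|t − s|` for `s, t ∈ (δ, T)` ((4.11)); and `ω = curl U`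
satisfies (4.8) with `u = U + b`, `div U = 0`, in time-integrated form,
`ω(t, x) − ω(s, x) = ∫ₛᵗ (Δω − Dω[U + b] + DU[ω])(τ, x) dτ` for all `x` and `0 < s ≤ t < T`.
The source proves this via Proposition 4.1, (3.11), (3.14) and Serrin's bootstrap; any pair
`(U, b)` as above is of the form required there (`u := U + b` is a bounded weak solution on
`(0, T)` with this decomposition). [cite: KochNadirashviliSereginSverak2009, §4 (4.8)–(4.11) with Prop. 4.1 and (3.10)–(3.14) (arXiv:0709.3599v1 pp. 6–8)] -/
def KNSS2009_driftMild_regularity : Prop :=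
  ∀ N T : ℝ, 0 < T →
    ∃ (C L : ℕ → ℝ → ℝ),
      ∀ ⦃U : ℝ → EuclideanSpace ℝ (Fin 3) → EuclideanSpace ℝ (Fin 3)⦄ ⦃b : ℝ → EuclideanSpace ℝ (Fin 3)⦄,
        IsKNSSDriftMild T N U b →
        (∀ t ∈ Ioo 0 T, ContDiff ℝ ∞ (U t)) ∧
        (∀ t ∈ Ioo 0 T, VectorCalculus.IsDivFree (U t)) ∧
        (∀ δ : ℝ, 0 < δ → ∀ k : ℕ, ∀ t ∈ Ioo δ T, ∀ x,
          ‖iteratedFDeriv ℝ k (U t) x‖ ≤ C k δ) ∧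
        (∀ δ : ℝ, 0 < δ → ∀ k : ℕ, ∀ s ∈ Ioo δ T, ∀ t ∈ Ioo δ T, ∀ x,
          ‖iteratedFDeriv ℝ k (U t) x - iteratedFDeriv ℝ k (U s) x‖ ≤ L k δ * |t - s|) ∧
        (∀ x, ∀ s t : ℝ, 0 < s → s ≤ t → t < T →
          curl (U t) x - curl (U s) x =
            ∫ τ in s..t, ((Δ (curl (U τ))) x - fderiv ℝ (curl (U τ)) x (U τ x + b τ) +
              fderiv ℝ (U τ) x (curl (U τ) x)))

/-- **Glue: the window regularity fact from its two halves.** KNSS's §4 closing paragraph for a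
bounded weak solution `u` on `ℝ³ × (0, T)` with `‖u‖ ≤ M`: Lemma 3.1 in drift-mild form
(`KNSS2009_weak_driftMild`) provides `u = U + b` a.e. with `IsKNSSDriftMild T N U b`,
`N = N(M, T)`, and the smoothing half (`KNSS2009_driftMild_regularity`) provides the constants
`C(k, δ), L(k, δ)` (depending on `N`, `T`, hence on `M`, `T`) and all regularity clauses of
`KNSS2009_regularity_boundedWeak_window`. [cite: KochNadirashviliSereginSverak2009, §4 closing paragraph (arXiv:0709.3599v1 p. 8)] -/
theorem KNSS2009_regularity_boundedWeak_window_of_driftMild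
    (h31 : KNSS2009_weak_driftMild) (hreg : KNSS2009_driftMild_regularity) :
    KNSS2009_regularity_boundedWeak_window := by
  intro M T hT
  obtain ⟨N, hN⟩ := h31 M T hT
  obtain ⟨C, L, hCL⟩ := hreg N T hT
  refine ⟨C, L, N, fun u hu hM => ?_⟩
  obtain ⟨U, b, hUb, hae⟩ := hN hu hM
  obtain ⟨h1, h2, h3, h4, h5⟩ := hCL hUb
  exact ⟨U, b, hUb.measurable_drift, hUb.norm_drift_le, hUb.measurable, hae, h1, h2, h3, h4,
    h5⟩

end Facts

end Literature.Analysis.FluidPDE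

end
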